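import Summits.QuantumFields.BalabanUV.Beta.NVertexLamSectorContracted

/-!
# `BalabanUV.Beta.NVertexLamSectorStoreyKernels` — row D1 ∕ (C1), PART 15: **THE Λ SECTOR OF THE N-VERTEX's FIELD BLOCK AS A SUM OF STOREY KERNELS IN
# THE ROAD's SANDWICH DISPLAY** — `cΛ · ℒN|ff = Σ_{k ≤ j} 𝒦ᴿ_k`, each `𝒦ᴿ_k` the sandwich of ONE displayed lattice core by an2's `compLinKer ℓ Lc k` (the (E4b)
# storey dictionary, row side: the road's `h𝒦` shape verbatim, the core = the (0.4)-symmetrised constraint-Hessian bricks weighted by the TRANSPORTED MULTIPLIER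
# RESPONSE `λ′ᴿ_k (κ, s) := Σ_ν Σ'_w Λ′_N (ν, w) · compLinKer ℓ Lc (j − k) (κ, s) (ν, w)`)

WHY (located).  Road FP g38's (E4b-shape) `FP/TorusLamJunctionShape.lamJunction_of_dper_eq` (p469378 ✓) reduces the Λ junction of the END wrapper's `hHN₁` to ONE
identity `hΛN : dper T (Σ_{j' ∈ range (n+2)} 𝒦_{j'}) = dper T ΛN`, where the road DISPLAYS its storey kernels window-free (`h𝒦`) as
`𝒦_{j'} β β' b b' = Σ_a Σ_{a'} Σ'_γ Σ'_{γ'} compLinKer ℓ Lc (n+1−j') (b, β) (a, γ) · 𝒢_{j'} γ γ' a a' · compLinKer ℓ Lc (n+1−j') (b', β') (a', γ')` (legs = an2's composite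
linear averaging kernel; core `𝒢_{j'}` = the wrapper's storey core `w j' · Σ_ā hb j' ā · (SLam N₁ (cf j') 𝒽 ā.2 ā.1)|ff`), and SPEC-49 §B (J-Λ-lat) names the row's tools:
F6a′ unrolling, F6a″ `liftUp_eq_sum_compLinKer`, F6a‴ `tsum_mul_compVHKer_eq`, and «per storey the weight word `w n k · hb n B k v ā = cΛ · Σ_m λ′_k (ā + T_k∘m)`».
PART 14 (`NVertexLamSectorContracted`, p471526 ✓) put the row's Λ sector in storey currency with the weight against an2's `storeyVH` (finite window sums,
legs inside).  THIS FILE re-displays each storey term IN THE ROAD's SANDWICH SHAPE: §1 (generic bricks `ℓ`, `𝓋` with `𝓋` bounded and window-supported)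
`storeyVH ℓ 𝓋 L k κ s f f'` IS the `compLinKer ℓ L k`-sandwich of the single brick `𝓋 k κ s` (`storeyVH_eq_sandwich`), and a summable slot weight passes
through the legs onto the core (**`tsum_weight_mul_storeyVH_eq_sandwich`**: `Σ_κ Σ'_s C κ s · storeyVH … k κ s f f' = Σ_a Σ_{a'} Σ'_γ Σ'_{γ'} compLinKer … f (a,γ) ·
(Σ_κ Σ'_s C κ s · 𝓋 k κ s (a,γ) (a',γ')) · compLinKer … f' (a',γ')` — every `γ`-sum finitely supported in the leg's upper box, every `s`-sum absolutely convergent);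
§2 (the record `R : Roots Lc`, `ℓ _ := symLinKerAt (toSite R.r) Lc`, `𝓋 _ := symHessKerAt (toSite R.r) Lc`) the pulled-back weight `λ′ᴿ_k` is summable in its slot
(`summable_pullback_LamN`, `summable_lamR`) and **`LN_inl_inl_eq_sum_storeySandwich`**:
  `cΛ · ℒN μ y x z (inl α) (inl β) = Σ_{k ∈ range (j+1)} Σ_a Σ_{a'} Σ'_γ Σ'_{γ'} compLinKer ℓ Lc k (α,x) (a,γ) · 𝒢ᴿ_k γ γ' a a' · compLinKer ℓ Lc k (β,z) (a',γ')`,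
  `𝒢ᴿ_k γ γ' a a' = −cΛ · Σ_κ Σ'_s λ′ᴿ_k (κ,s) · symHessKerAt (toSite R.r) Lc κ s (a,γ) (a',γ')` (written out; no `def`)
— so at `j := n+1`, `R := Roots.ctr Lc` (`Roots.ctr_r`: `toSite R.r = ctr 4 Lc`, the road's brick root) the row's storey `k` has the road's display at co-depth
`j' = n+1−k` with the SAME legs up to the road's per-step scalars `stepScale · Lc⁴` in `hℓ`, and the junction left per storey is between the two CORES:
`w j' · Σ_ā hb j' ā · (SLam N₁ (cf j') 𝒽 ā)|ff` against `−cΛ · Σ_κ Σ'_s λ′ᴿ_k (κ,s) · 𝒽 κ s|ff` — the road's weight word with `λ′_k := λ′ᴿ_k` (periodisation: PART 16).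

WHAT ([folklore] finite-sum ∕ `tsum` bookkeeping BY NAME; no `def`, no `def … : Prop`, nothing cited, 0 sorry): §1 `sum_offs_eq_sum_image`, `mem_image_offs_iff`,
`compLinKer_eq_zero_of_not_mem_box`, `storeyVH_eq_sum_box`, `storeyVH_eq_sandwich`, `summable_weight_mul_brick`, `tsum_weight_mul_storeyVH_eq_sandwich`;
§2 `summable_pullback_LamN`, `summable_lamR`, `sum_tsum_pullback_mul_eq`, **`LN_inl_inl_eq_sum_storeySandwich`**, `VN_inl_inl_eq_wilson_add_sum_storeySandwich`.
WHAT THIS IS NOT: not (J-Λ-lat) itself (the periodisation `dper T` of both sides and the per-storey core junction are PART 16 ∕ the road's); not (K1) for the nested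
column; not (J-W); no row of the END wrapper discharged; 0 estimates; nothing of Bałaban's asserted, valued or discharged; 0∕4 row-D1 binders (hW, hR, D1Tel, D1Rep);
ROOT M‴ p325680 ∕ P5c ∕ D6 untouched; NOT (C1), NOT (L2′), NOT D1, NEVER «G-an2-4 closed», NOT BetaPertH, NOT continuum, NOT Clay.

HONEST DEPENDENCY (page 1, mandatory): continuum YM on T⁴ ⇐ BetaPertH ∧ nine spine estimates (0/9 proved); BetaPertH ⇐ (D1) ∧ (D4) ∧ CAP+tail;
G-an2-4 gates asym, D1 and NE2/3/4.  HONEST FRAMING (cell contract, verbatim): «discharging `BetaPertH` makes Bałaban's UV stability UNCONDITIONAL —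
a real constructive-QFT result; it is NOT the continuum limit and NOT the Clay problem.»  ABSOLUTE RULE (cell charter, verbatim): «No internally-minted
statement may enter as a cited fact. Every hypothesis is either kernel-proved in this package or a verbatim quotation of a PUBLISHED theorem with page
reference. The manuscript(s) under audit are NOT citable for their own disputed steps — they are the thing under adjudication; programme-internal
(2001/route/tribunal) claims are never citable.»  Row D1 ∕ (C1) OWNER an2 (b2b-balaban-beta-an2) gen 62, 2026-08-27.  No existing file touched.
-/

noncomputable section

open scoped BigOperators

namespace Summit.QuantumFields.BalabanUV.Beta.NVertexLamSectorStoreyKernels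

open Finset
open Literature.MathematicalPhysics.QuantumFieldTheory
open Literature.MathematicalPhysics.QuantumFieldTheory.Balaban1983to89
open Literature.MathematicalPhysics.QuantumFieldTheory.Balaban1983to89.Beta
open AffineAveraging (Site box toSite)
open AveragingHessianKernels (Bond Near ell)
open OneStepResolventKernel (Fib KInv decays_KInv)
open OneStepKernelFamily (vertexOfK)
open InterLevelTransport (SLam)
open StepJetData (wilsonA)
open BalabanStepJets (lamCoeffOf abs_lamCoeffOf_le)
open Summit.QuantumFields.BalabanUV.Beta.AxialDressingRooted (one_le_of_neZero)
open Summit.QuantumFields.BalabanUV.Beta.SymAveragingHessianCounts (symLinKerAt symHessKerAt abs_symLinKerAt_le abs_symHessKerAt_le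
  symHessKerAt_eq_zero_left symHessKerAt_eq_zero_right)
open Summit.QuantumFields.BalabanUV.Beta.CompositeVertexKernelRec (offs compLinKer winF wid compLinKer_eq_zero near_iff_exists_offs
  smul_add_right_injective abs_compLinKer_le)
open Summit.QuantumFields.BalabanUV.Beta.CompositeVertexKernelUnroll (storeyVH)
open Summit.QuantumFields.BalabanUV.Beta.CompositeVertexKernelLiftKernel (mem_piFinset_of_mem_winF)
open Summit.QuantumFields.BalabanUV.Beta.CompositeVertexKernelLiftContract (summable_uncurry_pullback)
open Summit.QuantumFields.BalabanUV.Beta.CompositeOneShotJets (compH)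
open Summit.QuantumFields.BalabanUV.Beta.CompositeOneShotJetData (Roots Pins AN VN)
open Summit.QuantumFields.BalabanUV.Beta.NVertexSectors (decays_AN)
open Summit.QuantumFields.BalabanUV.Beta.NVertexLamSectorContracted (LN_inl_inl_contracted summable_LamN tsum_LamN_mul_compH_inl_inl_storeys
  VN_inl_inl_contracted)

variable {d : ℕ}

/-! ## §1 Generic: a storey term IS the `compLinKer`-sandwich of its brick; a summable slot weight passes onto the core -/

section Generic

variable {ℓ : ℕ → Fin (d + 1) → Site (d + 1) → Bond (d + 1) → ℝ}
  {𝓋 : ℕ → Fin (d + 1) → Site (d + 1) → Bond (d + 1) → Bond (d + 1) → ℝ} {L : ℕ}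

/-- [folklore] the window sum of one step read as a sum over the image finset of the window sites (`e ↦ L•s + e` is injective). -/
theorem sum_offs_eq_sum_image (F : Site (d + 1) → ℝ) (s : Site (d + 1)) :
    ∑ e ∈ offs L, F ((L : ℤ) • s + e) = ∑ γ ∈ (offs L).image (fun e => (L : ℤ) • s + e), F γ := by
  rw [Finset.sum_image fun e _ e' _ h => smul_add_right_injective L s h]

/-- [folklore] membership in the window image IS an1's `Near`. -/
theorem mem_image_offs_iff (s γ : Site (d + 1)) : γ ∈ (offs L).image (fun e => (L : ℤ) • s + e) ↔ Near L s γ := by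
  rw [near_iff_exists_offs, Finset.mem_image]
  exact ⟨fun ⟨e, he, h⟩ => ⟨e, he, h.symm⟩, fun ⟨e, he, h⟩ => ⟨e, he, h.symm⟩⟩

/-- [folklore] **the LEG's UPPER BOX**: `compLinKer ℓ L k f (a, γ)` vanishes unless the level-`k` site `γ` lies in the explicit finite box of the finest site `f.2`
(contrapositive of F6a″'s `mem_piFinset_of_mem_winF` through `compLinKer_eq_zero`; `0 < L`). -/
theorem compLinKer_eq_zero_of_not_mem_box (hL : 0 < L) (k : ℕ) (f : Bond (d + 1)) (a : Fin (d + 1)) {γ : Site (d + 1)}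
    (hγ : γ ∉ Fintype.piFinset fun i => Finset.Icc ((f.2 i - (wid L k : ℤ)) / ((L ^ k : ℕ) : ℤ)) (f.2 i / ((L ^ k : ℕ) : ℤ))) :
    compLinKer ℓ L k f (a, γ) = 0 :=
  compLinKer_eq_zero k (f := f) (g := (a, γ)) fun h => hγ (mem_piFinset_of_mem_winF (pow_pos hL k) h)

variable (h𝓋l : ∀ i μ y g g', ¬ Near L y g.2 → 𝓋 i μ y g g' = 0) (h𝓋r : ∀ i μ y g g', ¬ Near L y g'.2 → 𝓋 i μ y g g' = 0)
include h𝓋l h𝓋r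

/-- [folklore] **`storeyVH_eq_sum_box` — THE STOREY TERM OVER THE LEGS' UPPER BOXES**: for a window-supported brick family `𝓋`,
`storeyVH ℓ 𝓋 L k κ s f f' = Σ_a Σ_{a'} Σ_{γ ∈ Box f} Σ_{γ' ∈ Box f'} 𝓋 k κ s (a,γ) (a',γ') · compLinKer ℓ L k f (a,γ) · compLinKer ℓ L k f' (a',γ')` — both sides are the same
finitely supported double sum (the window sum loses nothing off `Box`, the box sum nothing off the window). -/
theorem storeyVH_eq_sum_box (hL : 0 < L) (k : ℕ) (κ : Fin (d + 1)) (s : Site (d + 1)) (f f' : Bond (d + 1)) :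
    storeyVH ℓ 𝓋 L k κ s f f'
      = ∑ a : Fin (d + 1), ∑ a' : Fin (d + 1),
          ∑ γ ∈ Fintype.piFinset (fun i => Finset.Icc ((f.2 i - (wid L k : ℤ)) / ((L ^ k : ℕ) : ℤ)) (f.2 i / ((L ^ k : ℕ) : ℤ))),
            ∑ γ' ∈ Fintype.piFinset (fun i => Finset.Icc ((f'.2 i - (wid L k : ℤ)) / ((L ^ k : ℕ) : ℤ)) (f'.2 i / ((L ^ k : ℕ) : ℤ))),
              𝓋 k κ s (a, γ) (a', γ') * compLinKer ℓ L k f (a, γ) * compLinKer ℓ L k f' (a', γ') := by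
  classical
  set B := Fintype.piFinset (fun i => Finset.Icc ((f.2 i - (wid L k : ℤ)) / ((L ^ k : ℕ) : ℤ)) (f.2 i / ((L ^ k : ℕ) : ℤ))) with hB
  set B' := Fintype.piFinset (fun i => Finset.Icc ((f'.2 i - (wid L k : ℤ)) / ((L ^ k : ℕ) : ℤ)) (f'.2 i / ((L ^ k : ℕ) : ℤ))) with hB'
  set W := (offs L).image (fun e => (L : ℤ) • s + e) with hW
  -- both sides as the double sum over `W ∪ B`, `W ∪ B'`
  have hLHS : storeyVH ℓ 𝓋 L k κ s f f'
      = ∑ a : Fin (d + 1), ∑ a' : Fin (d + 1), ∑ γ ∈ W, ∑ γ' ∈ W,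
          𝓋 k κ s (a, γ) (a', γ') * compLinKer ℓ L k f (a, γ) * compLinKer ℓ L k f' (a', γ') := by
    unfold storeyVH
    refine Finset.sum_congr rfl fun a _ => ?_
    rw [Finset.sum_comm]
    refine Finset.sum_congr rfl fun a' _ => ?_
    rw [sum_offs_eq_sum_image (L := L) (fun γ => ∑ e' ∈ offs L,
      𝓋 k κ s (a, γ) (a', (L : ℤ) • s + e') * compLinKer ℓ L k f (a, γ) * compLinKer ℓ L k f' (a', (L : ℤ) • s + e')) s]
    refine Finset.sum_congr rfl fun γ _ => ?_
    exact sum_offs_eq_sum_image (L := L) (fun γ' => 𝓋 k κ s (a, γ) (a', γ') * compLinKer ℓ L k f (a, γ) * compLinKer ℓ L k f' (a', γ')) s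
  have hW0 : ∀ (a a' : Fin (d + 1)) (γ γ' : Site (d + 1)), γ ∉ W →
      𝓋 k κ s (a, γ) (a', γ') * compLinKer ℓ L k f (a, γ) * compLinKer ℓ L k f' (a', γ') = 0 := fun a a' γ γ' hγ => by
    rw [h𝓋l k κ s (a, γ) (a', γ') (fun h => hγ ((mem_image_offs_iff s γ).2 h)), zero_mul, zero_mul]
  have hW0' : ∀ (a a' : Fin (d + 1)) (γ γ' : Site (d + 1)), γ' ∉ W →
      𝓋 k κ s (a, γ) (a', γ') * compLinKer ℓ L k f (a, γ) * compLinKer ℓ L k f' (a', γ') = 0 := fun a a' γ γ' hγ' => by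
    rw [h𝓋r k κ s (a, γ) (a', γ') (fun h => hγ' ((mem_image_offs_iff s γ').2 h)), zero_mul, zero_mul]
  have hB0 : ∀ (a a' : Fin (d + 1)) (γ γ' : Site (d + 1)), γ ∉ B →
      𝓋 k κ s (a, γ) (a', γ') * compLinKer ℓ L k f (a, γ) * compLinKer ℓ L k f' (a', γ') = 0 := fun a a' γ γ' hγ => by
    rw [compLinKer_eq_zero_of_not_mem_box hL k f a hγ, mul_zero, zero_mul]
  have hB0' : ∀ (a a' : Fin (d + 1)) (γ γ' : Site (d + 1)), γ' ∉ B' →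
      𝓋 k κ s (a, γ) (a', γ') * compLinKer ℓ L k f (a, γ) * compLinKer ℓ L k f' (a', γ') = 0 := fun a a' γ γ' hγ' => by
    rw [compLinKer_eq_zero_of_not_mem_box hL k f' a' hγ', mul_zero]
  rw [hLHS]
  refine Finset.sum_congr rfl fun a _ => Finset.sum_congr rfl fun a' _ => ?_
  -- extend the inner and outer sums on both sides to the unions
  have hl : ∑ γ ∈ W, ∑ γ' ∈ W, 𝓋 k κ s (a, γ) (a', γ') * compLinKer ℓ L k f (a, γ) * compLinKer ℓ L k f' (a', γ')
      = ∑ γ ∈ W ∪ B, ∑ γ' ∈ W ∪ B', 𝓋 k κ s (a, γ) (a', γ') * compLinKer ℓ L k f (a, γ) * compLinKer ℓ L k f' (a', γ') := by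
    rw [Finset.sum_subset (Finset.subset_union_left (s₂ := B)) fun γ _ hγ => Finset.sum_eq_zero fun γ' _ => hW0 a a' γ γ' hγ]
    exact Finset.sum_congr rfl fun γ _ => Finset.sum_subset (Finset.subset_union_left (s₂ := B')) fun γ' _ hγ' => hW0' a a' γ γ' hγ'
  have hr : ∑ γ ∈ B, ∑ γ' ∈ B', 𝓋 k κ s (a, γ) (a', γ') * compLinKer ℓ L k f (a, γ) * compLinKer ℓ L k f' (a', γ')
      = ∑ γ ∈ W ∪ B, ∑ γ' ∈ W ∪ B', 𝓋 k κ s (a, γ) (a', γ') * compLinKer ℓ L k f (a, γ) * compLinKer ℓ L k f' (a', γ') := by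
    rw [Finset.sum_subset (Finset.subset_union_right (s₁ := W)) fun γ _ hγ => Finset.sum_eq_zero fun γ' _ => hB0 a a' γ γ' hγ]
    exact Finset.sum_congr rfl fun γ _ => Finset.sum_subset (Finset.subset_union_right (s₁ := W)) fun γ' _ hγ' => hB0' a a' γ γ' hγ'
  rw [hl, hr]

/-- [folklore] **`storeyVH_eq_sandwich` — THE STOREY TERM IS THE `compLinKer`-SANDWICH OF ITS BRICK, window-free**:
`storeyVH ℓ 𝓋 L k κ s f f' = Σ_a Σ_{a'} Σ'_γ Σ'_{γ'} compLinKer ℓ L k f (a,γ) · 𝓋 k κ s (a,γ) (a',γ') · compLinKer ℓ L k f' (a',γ')` (both `tsum`s finitely supported in the legs'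
boxes) — the road's `h𝒦` display of a storey kernel, for ONE brick. -/
theorem storeyVH_eq_sandwich (hL : 0 < L) (k : ℕ) (κ : Fin (d + 1)) (s : Site (d + 1)) (f f' : Bond (d + 1)) :
    storeyVH ℓ 𝓋 L k κ s f f'
      = ∑ a : Fin (d + 1), ∑ a' : Fin (d + 1), ∑' γ : Site (d + 1), ∑' γ' : Site (d + 1),
          compLinKer ℓ L k f (a, γ) * 𝓋 k κ s (a, γ) (a', γ') * compLinKer ℓ L k f' (a', γ') := by
  rw [storeyVH_eq_sum_box h𝓋l h𝓋r hL k κ s f f']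
  refine Finset.sum_congr rfl fun a _ => Finset.sum_congr rfl fun a' _ => ?_
  rw [tsum_eq_sum (s := Fintype.piFinset (fun i => Finset.Icc ((f.2 i - (wid L k : ℤ)) / ((L ^ k : ℕ) : ℤ)) (f.2 i / ((L ^ k : ℕ) : ℤ))))
    (fun γ hγ => by simp only [compLinKer_eq_zero_of_not_mem_box hL k f a hγ, zero_mul, tsum_zero])]
  refine Finset.sum_congr rfl fun γ _ => ?_
  rw [tsum_eq_sum (s := Fintype.piFinset (fun i => Finset.Icc ((f'.2 i - (wid L k : ℤ)) / ((L ^ k : ℕ) : ℤ)) (f'.2 i / ((L ^ k : ℕ) : ℤ))))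
    (fun γ' hγ' => by rw [compLinKer_eq_zero_of_not_mem_box hL k f' a' hγ', mul_zero])]
  exact Finset.sum_congr rfl fun γ' _ => by ring

omit h𝓋l h𝓋r in
/-- [folklore] a summable slot weight against a bounded brick entry is summable. -/
theorem summable_weight_mul_brick {B𝓋 : ℝ} (h𝓋b : ∀ i μ y g g', |𝓋 i μ y g g'| ≤ B𝓋) {C : Fin (d + 1) → Site (d + 1) → ℝ}
    (hC : ∀ κ, Summable (C κ)) (k : ℕ) (κ : Fin (d + 1)) (g g' : Bond (d + 1)) :
    Summable fun s : Site (d + 1) => C κ s * 𝓋 k κ s g g' :=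
  KKTFluctuationEnergy.summable_mul_of_bdd' (hC κ) fun s => h𝓋b k κ s g g'

/-- [folklore] **`tsum_weight_mul_storeyVH_eq_sandwich` — A SUMMABLE SLOT WEIGHT PASSES THROUGH THE LEGS ONTO THE CORE**: for a bounded, window-supported
brick family and a slot weight `C` summable in the slot site,
`Σ_κ Σ'_s C κ s · storeyVH ℓ 𝓋 L k κ s f f' = Σ_a Σ_{a'} Σ'_γ Σ'_{γ'} compLinKer ℓ L k f (a,γ) · (Σ_κ Σ'_s C κ s · 𝓋 k κ s (a,γ) (a',γ')) · compLinKer ℓ L k f' (a',γ')`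
— the road's `h𝒦` display with the WEIGHTED CORE `Σ_κ Σ'_s C κ s · 𝓋 k κ s`. -/
theorem tsum_weight_mul_storeyVH_eq_sandwich (hL : 0 < L) {B𝓋 : ℝ} (h𝓋b : ∀ i μ y g g', |𝓋 i μ y g g'| ≤ B𝓋)
    {C : Fin (d + 1) → Site (d + 1) → ℝ} (hC : ∀ κ, Summable (C κ)) (k : ℕ) (f f' : Bond (d + 1)) :
    ∑ κ : Fin (d + 1), ∑' s : Site (d + 1), C κ s * storeyVH ℓ 𝓋 L k κ s f f'
      = ∑ a : Fin (d + 1), ∑ a' : Fin (d + 1), ∑' γ : Site (d + 1), ∑' γ' : Site (d + 1),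
          compLinKer ℓ L k f (a, γ) * (∑ κ : Fin (d + 1), ∑' s : Site (d + 1), C κ s * 𝓋 k κ s (a, γ) (a', γ'))
            * compLinKer ℓ L k f' (a', γ') := by
  classical
  set B := Fintype.piFinset (fun i => Finset.Icc ((f.2 i - (wid L k : ℤ)) / ((L ^ k : ℕ) : ℤ)) (f.2 i / ((L ^ k : ℕ) : ℤ))) with hB
  set B' := Fintype.piFinset (fun i => Finset.Icc ((f'.2 i - (wid L k : ℤ)) / ((L ^ k : ℕ) : ℤ)) (f'.2 i / ((L ^ k : ℕ) : ℤ))) with hB'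
  -- the termwise summability in the slot site (the legs are constants there)
  have hterm : ∀ (κ a a' : Fin (d + 1)) (γ γ' : Site (d + 1)), Summable fun s : Site (d + 1) =>
      C κ s * (𝓋 k κ s (a, γ) (a', γ') * compLinKer ℓ L k f (a, γ) * compLinKer ℓ L k f' (a', γ')) := fun κ a a' γ γ' =>
    ((summable_weight_mul_brick h𝓋b hC k κ (a, γ) (a', γ')).mul_right (compLinKer ℓ L k f (a, γ) * compLinKer ℓ L k f' (a', γ'))).congr
      fun s => by ring
  -- LHS: expand the storey term over the boxes, push the weight in, exchange the slot `tsum` with the four finite sums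
  have hL1 : ∀ κ : Fin (d + 1), ∑' s : Site (d + 1), C κ s * storeyVH ℓ 𝓋 L k κ s f f'
      = ∑ a : Fin (d + 1), ∑ a' : Fin (d + 1), ∑ γ ∈ B, ∑ γ' ∈ B', ∑' s : Site (d + 1),
          C κ s * (𝓋 k κ s (a, γ) (a', γ') * compLinKer ℓ L k f (a, γ) * compLinKer ℓ L k f' (a', γ')) := fun κ => by
    have h1 : ∀ s : Site (d + 1), C κ s * storeyVH ℓ 𝓋 L k κ s f f'
        = ∑ a : Fin (d + 1), ∑ a' : Fin (d + 1), ∑ γ ∈ B, ∑ γ' ∈ B',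
            C κ s * (𝓋 k κ s (a, γ) (a', γ') * compLinKer ℓ L k f (a, γ) * compLinKer ℓ L k f' (a', γ')) := fun s => by
      rw [storeyVH_eq_sum_box h𝓋l h𝓋r hL k κ s f f', ← hB, ← hB']
      simp only [Finset.mul_sum]
    rw [tsum_congr h1]
    rw [Summable.tsum_finsetSum fun a _ => summable_sum fun a' _ => summable_sum fun γ _ => summable_sum fun γ' _ => hterm κ a a' γ γ']
    refine Finset.sum_congr rfl fun a _ => ?_
    rw [Summable.tsum_finsetSum fun a' _ => summable_sum fun γ _ => summable_sum fun γ' _ => hterm κ a a' γ γ']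
    refine Finset.sum_congr rfl fun a' _ => ?_
    rw [Summable.tsum_finsetSum fun γ _ => summable_sum fun γ' _ => hterm κ a a' γ γ']
    refine Finset.sum_congr rfl fun γ _ => ?_
    exact Summable.tsum_finsetSum fun γ' _ => hterm κ a a' γ γ'
  -- RHS: the legs cut the `γ`-sums down to the boxes
  have hR1 : ∀ a a' : Fin (d + 1),
      (∑' γ : Site (d + 1), ∑' γ' : Site (d + 1), compLinKer ℓ L k f (a, γ)
          * (∑ κ : Fin (d + 1), ∑' s : Site (d + 1), C κ s * 𝓋 k κ s (a, γ) (a', γ')) * compLinKer ℓ L k f' (a', γ'))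
        = ∑ γ ∈ B, ∑ γ' ∈ B', compLinKer ℓ L k f (a, γ)
          * (∑ κ : Fin (d + 1), ∑' s : Site (d + 1), C κ s * 𝓋 k κ s (a, γ) (a', γ')) * compLinKer ℓ L k f' (a', γ') := fun a a' => by
    rw [tsum_eq_sum (s := B) (fun γ hγ => by simp only [compLinKer_eq_zero_of_not_mem_box hL k f a hγ, zero_mul, tsum_zero])]
    refine Finset.sum_congr rfl fun γ _ => ?_
    exact tsum_eq_sum (s := B') (fun γ' hγ' => by rw [compLinKer_eq_zero_of_not_mem_box hL k f' a' hγ', mul_zero])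
  -- per box term: the weight sum times the two legs
  have hR2 : ∀ (a a' : Fin (d + 1)) (γ γ' : Site (d + 1)),
      compLinKer ℓ L k f (a, γ) * (∑ κ : Fin (d + 1), ∑' s : Site (d + 1), C κ s * 𝓋 k κ s (a, γ) (a', γ')) * compLinKer ℓ L k f' (a', γ')
        = ∑ κ : Fin (d + 1), ∑' s : Site (d + 1),
            C κ s * (𝓋 k κ s (a, γ) (a', γ') * compLinKer ℓ L k f (a, γ) * compLinKer ℓ L k f' (a', γ')) := fun a a' γ γ' => by
    rw [Finset.mul_sum, Finset.sum_mul]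
    refine Finset.sum_congr rfl fun κ _ => ?_
    rw [← tsum_mul_left, ← tsum_mul_right]
    exact tsum_congr fun s => by ring
  simp_rw [hL1, hR1, hR2]
  -- the finite `κ`-sum goes inside the four finite sums
  rw [Finset.sum_comm]
  refine Finset.sum_congr rfl fun a _ => ?_
  rw [Finset.sum_comm]
  refine Finset.sum_congr rfl fun a' _ => ?_
  rw [Finset.sum_comm]
  refine Finset.sum_congr rfl fun γ _ => ?_
  rw [Finset.sum_comm]

end Generic

/-! ## §2 At the record: `cΛ · ℒN|ff` as a sum of storey sandwiches, the transported multiplier response on the cores -/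

section Record

variable {Lc : ℕ} [NeZero Lc] (R : Roots Lc) (P : Pins) (j : ℕ)

/-- [folklore] **the PULLED-BACK multiplier response is summable in the storey slot**: for every `ν κ m`,
`s ↦ Σ'_w Λ′_N μ y ν w · compLinKer ℓ Lc m (κ, s) (ν, w)` is summable (F6a‴'s `summable_uncurry_pullback` at the constant slot function `1` with `summable_LamN`;
each `w`-sum is finitely supported by the leg's upper window). -/
theorem summable_pullback_LamN (μ ν κ : Fin (3 + 1)) (y : Site (3 + 1)) (m : ℕ) :
    Summable fun s : Site (3 + 1) => ∑' w : Site (3 + 1),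
      (∑ κ' : Fin (3 + 1), ∑' u : Site (3 + 1),
          AN R j u (((Lc ^ (j + 1) : ℕ) : ℤ) • y) (Sum.inl κ') (Sum.inr μ) * lamCoeffOf (KInv (N := Lc ^ (j + 1)) (d := 3)) (Lc ^ (j + 1)) ν w κ' u)
        * compLinKer (fun _ => symLinKerAt (toSite R.r) Lc) Lc m (κ, s) (ν, w) := by
  have hL1 : 1 ≤ Lc := one_le_of_neZero Lc
  have h := (summable_uncurry_pullback (ℓ := fun _ => symLinKerAt (toSite R.r) Lc) (L := Lc) (F := fun _ _ => (1 : ℝ)) (BF := 1)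
    (by positivity : (0 : ℝ) ≤ (ell (3 + 1) Lc : ℝ)) (fun _ μ' y' g => abs_symLinKerAt_le hL1 μ' y' R.hr g) (fun _ _ => by rw [abs_one]) 0 m
    (summable_LamN R j μ ν y) κ ν).prod_symm.prod
  refine h.congr fun s => tsum_congr fun w => ?_
  dsimp only [Function.uncurry, Prod.swap]
  rw [mul_one]

/-- [folklore] **the TRANSPORTED MULTIPLIER RESPONSE `λ′ᴿ (κ, ·) := Σ_ν Σ'_w Λ′_N μ y ν w · compLinKer ℓ Lc m (κ, ·) (ν, w)` is summable** (finite sum of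
`summable_pullback_LamN`). -/
theorem summable_lamR (μ κ : Fin (3 + 1)) (y : Site (3 + 1)) (m : ℕ) :
    Summable fun s : Site (3 + 1) => ∑ ν : Fin (3 + 1), ∑' w : Site (3 + 1),
      (∑ κ' : Fin (3 + 1), ∑' u : Site (3 + 1),
          AN R j u (((Lc ^ (j + 1) : ℕ) : ℤ) • y) (Sum.inl κ') (Sum.inr μ) * lamCoeffOf (KInv (N := Lc ^ (j + 1)) (d := 3)) (Lc ^ (j + 1)) ν w κ' u)
        * compLinKer (fun _ => symLinKerAt (toSite R.r) Lc) Lc m (κ, s) (ν, w) :=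
  summable_sum fun ν _ => summable_pullback_LamN R j μ ν κ y m

/-- [folklore] the record's storey term is bounded (F6a‴ `abs_storeyVH_le` at the symmetrised bricks' bounds). -/
theorem abs_storeyVH_record_le (k : ℕ) (κ : Fin (3 + 1)) (s : Site (3 + 1)) (f f' : Bond (3 + 1)) :
    |storeyVH (fun _ => symLinKerAt (toSite R.r) Lc) (fun _ => symHessKerAt (toSite R.r) Lc) Lc k κ s f f'|
      ≤ ((((3 : ℕ) : ℝ) + 1) * (2 * (Lc : ℝ)) ^ (3 + 1)) ^ 2 * (2 * (ell (3 + 1) Lc : ℝ) ^ 2)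
          * (((((3 : ℕ) : ℝ) + 1) * (2 * (Lc : ℝ)) ^ (3 + 1) * (ell (3 + 1) Lc : ℝ)) ^ k) ^ 2 := by
  have hL1 : 1 ≤ Lc := one_le_of_neZero Lc
  exact CompositeVertexKernelLiftContract.abs_storeyVH_le (ℓ := fun _ => symLinKerAt (toSite R.r) Lc) (𝓋 := fun _ => symHessKerAt (toSite R.r) Lc)
    (L := Lc) (by positivity : (0 : ℝ) ≤ (ell (3 + 1) Lc : ℝ)) (fun _ μ' y' g => abs_symLinKerAt_le hL1 μ' y' R.hr g)
    (by positivity : (0 : ℝ) ≤ 2 * (ell (3 + 1) Lc : ℝ) ^ 2) (fun _ μ' y' g g' => abs_symHessKerAt_le hL1 μ' y' R.hr g g') k κ s f f'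

/-- [folklore] **the finite `ν`-sum merges into the weight**: against the record's storey term,
`Σ_ν Σ_κ Σ'_s (Σ'_w Λ′_N ν w · compLinKer … (κ,s) (ν,w)) · storeyVH … k κ s f f' = Σ_κ Σ'_s λ′ᴿ (κ,s) · storeyVH … k κ s f f'`. -/
theorem sum_tsum_pullback_mul_storeyVH_eq (μ : Fin (3 + 1)) (y : Site (3 + 1)) (m k : ℕ) (f f' : Bond (3 + 1)) :
    ∑ ν : Fin (3 + 1), ∑ κ : Fin (3 + 1), ∑' s : Site (3 + 1),
        (∑' w : Site (3 + 1),
            (∑ κ' : Fin (3 + 1), ∑' u : Site (3 + 1),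
                AN R j u (((Lc ^ (j + 1) : ℕ) : ℤ) • y) (Sum.inl κ') (Sum.inr μ) * lamCoeffOf (KInv (N := Lc ^ (j + 1)) (d := 3)) (Lc ^ (j + 1)) ν w κ' u)
              * compLinKer (fun _ => symLinKerAt (toSite R.r) Lc) Lc m (κ, s) (ν, w))
          * storeyVH (fun _ => symLinKerAt (toSite R.r) Lc) (fun _ => symHessKerAt (toSite R.r) Lc) Lc k κ s f f'
      = ∑ κ : Fin (3 + 1), ∑' s : Site (3 + 1),
          (∑ ν : Fin (3 + 1), ∑' w : Site (3 + 1),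
              (∑ κ' : Fin (3 + 1), ∑' u : Site (3 + 1),
                  AN R j u (((Lc ^ (j + 1) : ℕ) : ℤ) • y) (Sum.inl κ') (Sum.inr μ) * lamCoeffOf (KInv (N := Lc ^ (j + 1)) (d := 3)) (Lc ^ (j + 1)) ν w κ' u)
                * compLinKer (fun _ => symLinKerAt (toSite R.r) Lc) Lc m (κ, s) (ν, w))
            * storeyVH (fun _ => symLinKerAt (toSite R.r) Lc) (fun _ => symHessKerAt (toSite R.r) Lc) Lc k κ s f f' := by
  have hsum : ∀ ν κ : Fin (3 + 1), Summable fun s : Site (3 + 1) =>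
      (∑' w : Site (3 + 1),
          (∑ κ' : Fin (3 + 1), ∑' u : Site (3 + 1),
              AN R j u (((Lc ^ (j + 1) : ℕ) : ℤ) • y) (Sum.inl κ') (Sum.inr μ) * lamCoeffOf (KInv (N := Lc ^ (j + 1)) (d := 3)) (Lc ^ (j + 1)) ν w κ' u)
            * compLinKer (fun _ => symLinKerAt (toSite R.r) Lc) Lc m (κ, s) (ν, w))
        * storeyVH (fun _ => symLinKerAt (toSite R.r) Lc) (fun _ => symHessKerAt (toSite R.r) Lc) Lc k κ s f f' := fun ν κ =>
    KKTFluctuationEnergy.summable_mul_of_bdd' (summable_pullback_LamN R j μ ν κ y m) fun s => abs_storeyVH_record_le R k κ s f f'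
  rw [Finset.sum_comm]
  refine Finset.sum_congr rfl fun κ _ => ?_
  rw [← Summable.tsum_finsetSum fun ν _ => hsum ν κ]
  exact tsum_congr fun s => by rw [Finset.sum_mul]

/-- [folklore] **`LN_inl_inl_eq_sum_storeySandwich` — THE Λ SECTOR OF THE N-VERTEX's FIELD BLOCK IS A SUM OF STOREY KERNELS IN THE ROAD's SANDWICH DISPLAY**:
`cΛ (j+1) · ℒN μ y x z (inl α) (inl β) = Σ_{k ∈ range (j+1)} Σ_a Σ_{a'} Σ'_γ Σ'_{γ'} compLinKer ℓ Lc k (α,x) (a,γ) · 𝒢ᴿ_k γ γ' a a' · compLinKer ℓ Lc k (β,z) (a',γ')` with the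
DISPLAYED CORE `𝒢ᴿ_k γ γ' a a' = −cΛ (j+1) · Σ_κ Σ'_s λ′ᴿ_k (κ,s) · symHessKerAt (toSite R.r) Lc κ s (a,γ) (a',γ')`,
`λ′ᴿ_k (κ,s) = Σ_ν Σ'_w (Σ_{κ′} Σ'_u (AN R j) u (L•y) (inl κ′) (inr μ) · lamCoeffOf (KInv L) L ν w κ′ u) · compLinKer ℓ Lc (j−k) (κ,s) (ν,w)`, `L = Lc^(j+1)`,
`ℓ _ := symLinKerAt (toSite R.r) Lc` (PART 14's `LN_inl_inl_contracted` + `tsum_LamN_mul_compH_inl_inl_storeys`, the `ν`-sum merged, §1 per storey). -/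
theorem LN_inl_inl_eq_sum_storeySandwich (μ : Fin (3 + 1)) (y x z : Site (3 + 1)) (α β : Fin (3 + 1)) :
    P.cΛ (j + 1) * vertexOfK (AN R j) (Lc ^ (j + 1))
        (SLam (Lc ^ (j + 1)) (lamCoeffOf (KInv (N := Lc ^ (j + 1)) (d := 3)) (Lc ^ (j + 1))) (compH R.r Lc (j + 1))) μ y x z (Sum.inl α) (Sum.inl β)
      = ∑ k ∈ range (j + 1), ∑ a : Fin (3 + 1), ∑ a' : Fin (3 + 1), ∑' γ : Site (3 + 1), ∑' γ' : Site (3 + 1),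
          compLinKer (fun _ => symLinKerAt (toSite R.r) Lc) Lc k (α, x) (a, γ)
            * (-(P.cΛ (j + 1)) * ∑ κ : Fin (3 + 1), ∑' s : Site (3 + 1),
                (∑ ν : Fin (3 + 1), ∑' w : Site (3 + 1),
                    (∑ κ' : Fin (3 + 1), ∑' u : Site (3 + 1),
                        AN R j u (((Lc ^ (j + 1) : ℕ) : ℤ) • y) (Sum.inl κ') (Sum.inr μ)
                          * lamCoeffOf (KInv (N := Lc ^ (j + 1)) (d := 3)) (Lc ^ (j + 1)) ν w κ' u)
                      * compLinKer (fun _ => symLinKerAt (toSite R.r) Lc) Lc (j - k) (κ, s) (ν, w))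
                  * symHessKerAt (toSite R.r) Lc κ s (a, γ) (a', γ'))
            * compLinKer (fun _ => symLinKerAt (toSite R.r) Lc) Lc k (β, z) (a', γ') := by
  have hL : 0 < Lc := Nat.pos_of_ne_zero (NeZero.ne Lc)
  have hL1 : 1 ≤ Lc := one_le_of_neZero Lc
  have h𝓋l : ∀ (i : ℕ) (μ' : Fin (3 + 1)) (y' : Site (3 + 1)) (g g' : Bond (3 + 1)), ¬ Near Lc y' g.2 →
      (fun _ : ℕ => symHessKerAt (toSite R.r) Lc) i μ' y' g g' = 0 := fun _ μ' y' g g' h => symHessKerAt_eq_zero_left R.hr h g'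
  have h𝓋r : ∀ (i : ℕ) (μ' : Fin (3 + 1)) (y' : Site (3 + 1)) (g g' : Bond (3 + 1)), ¬ Near Lc y' g'.2 →
      (fun _ : ℕ => symHessKerAt (toSite R.r) Lc) i μ' y' g g' = 0 := fun _ μ' y' g g' h => symHessKerAt_eq_zero_right R.hr g h
  have h𝓋b : ∀ (i : ℕ) (μ' : Fin (3 + 1)) (y' : Site (3 + 1)) (g g' : Bond (3 + 1)),
      |(fun _ : ℕ => symHessKerAt (toSite R.r) Lc) i μ' y' g g'| ≤ 2 * (ell (3 + 1) Lc : ℝ) ^ 2 := fun _ μ' y' g g' => abs_symHessKerAt_le hL1 μ' y' R.hr g g'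
  rw [LN_inl_inl_contracted R j μ y x z (Sum.inl α) (Sum.inl β)]
  simp only [tsum_LamN_mul_compH_inl_inl_storeys]
  rw [Finset.sum_comm, mul_neg, ← neg_mul, Finset.mul_sum]
  refine Finset.sum_congr rfl fun k _ => ?_
  rw [sum_tsum_pullback_mul_storeyVH_eq R j μ y (j - k) k (α, x) (β, z),
    tsum_weight_mul_storeyVH_eq_sandwich h𝓋l h𝓋r hL h𝓋b (summable_lamR R j μ · y (j - k)) k (α, x) (β, z), Finset.mul_sum]
  refine Finset.sum_congr rfl fun a _ => ?_
  rw [Finset.mul_sum]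
  refine Finset.sum_congr rfl fun a' _ => ?_
  rw [← tsum_mul_left]
  refine tsum_congr fun γ => ?_
  rw [← tsum_mul_left]
  exact tsum_congr fun γ' => by ring

/-- [folklore] **`VN_inl_inl_eq_wilson_add_sum_storeySandwich` — THE FIELD BLOCK OF THE N-VERTEX: WILSON SECTOR + THE STOREY SANDWICHES** (PART 10's
`VN_inl_inl` with `LN_inl_inl_eq_sum_storeySandwich`). -/
theorem VN_inl_inl_eq_wilson_add_sum_storeySandwich (μ : Fin (3 + 1)) (y x z : Site (3 + 1)) (α β : Fin (3 + 1)) :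
    VN R P j μ y x z (Sum.inl α) (Sum.inl β)
      = P.cE (j + 1) * vertexOfK (AN R j) (Lc ^ (j + 1)) (wilsonA 3) μ y x z (Sum.inl α) (Sum.inl β)
        + ∑ k ∈ range (j + 1), ∑ a : Fin (3 + 1), ∑ a' : Fin (3 + 1), ∑' γ : Site (3 + 1), ∑' γ' : Site (3 + 1),
          compLinKer (fun _ => symLinKerAt (toSite R.r) Lc) Lc k (α, x) (a, γ)
            * (-(P.cΛ (j + 1)) * ∑ κ : Fin (3 + 1), ∑' s : Site (3 + 1),
                (∑ ν : Fin (3 + 1), ∑' w : Site (3 + 1),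
                    (∑ κ' : Fin (3 + 1), ∑' u : Site (3 + 1),
                        AN R j u (((Lc ^ (j + 1) : ℕ) : ℤ) • y) (Sum.inl κ') (Sum.inr μ)
                          * lamCoeffOf (KInv (N := Lc ^ (j + 1)) (d := 3)) (Lc ^ (j + 1)) ν w κ' u)
                      * compLinKer (fun _ => symLinKerAt (toSite R.r) Lc) Lc (j - k) (κ, s) (ν, w))
                  * symHessKerAt (toSite R.r) Lc κ s (a, γ) (a', γ'))
            * compLinKer (fun _ => symLinKerAt (toSite R.r) Lc) Lc k (β, z) (a', γ') := by
  rw [NVertexSectors.VN_inl_inl, LN_inl_inl_eq_sum_storeySandwich]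

end Record

end Summit.QuantumFields.BalabanUV.Beta.NVertexLamSectorStoreyKernels

end
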